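import Mathlib
import Summits.ResolutionOfSingularities.ResolutionOfSingularities.Theorems.RadicialJungCleanModelsCleanProp44ExceptionalCurveClassification
import HarnessLib

/-!
# Route `RadicialJung`, crux `CleanModels` (stmt-ResolutionOfSingularities-15917), line `Sketch` rev 35, stub 6 `stub_cleanProp44` (X44c):
# CLEAN-PERMISSIBILITY OF EXCEPTIONAL CURVES — SIDE FAMILIES WITH ARBITRARY EXPONENTS (sides of exponent divisible by `p` are absorbed)

Seat decomp-res-hand-2 g19 (structural hand); sequel of ✓ `…CleanProp44SideFamilyClassification.lean` / ✓ `…CleanProp44ExceptionalCurveClassification.lean`.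
Those classifications ask every exponent in sight to be `0` or prime to `p` — the currency of a FRESH clean normal form (✓ `exists_cleanRegAt_normalForm`).
Along a CHAIN of blowing ups, however, the raw transform data carry exponents divisible by `p` (the exceptional component `e'^A` with `p ∣ A ≠ 0`, or
`E''^{A + a_{k₁} + a_{k₂}}` after inserting at a corner; memo `Sketch-memo-hand2-g18-stubs-5-7.md` §2 (d) (vi)), and re-normalising through `CleanRegAt`
loses the identification of the sides one is tracking.  Here the hypothesis is dropped: a side `s_j` with `p ∣ ex_j` is a `p`-th power factor of the
representative, removed by ✓ `exists_rep_of_rep_eq_mul_pow`; it still passes through the point but NEVER obstructs.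

* `prod_pow_eq_prod_pow_mod_mul_pow` — `∏ s_j^{ex_j} = ∏ s_j^{ex'_j} · (∏ s_j^{q_j})^p` with `ex' = ex` off the multiples of `p` and `0` on them.
* `cleanPermissibleAt_or_obstruction_of_sideFamily_general` — the side-family classification with ARBITRARY exponents: clean-permissible ∨ CORNER (two sides
  with exponents PRIME TO `p`, `(e', s_{j₁}, s_{j₂}) = 𝔪`, neither in `N`) ∨ TANGENT (a side with exponent prime to `p` in `(N + 𝔪²) ∖ N`) ∨ BIRTH (`p`
  divides `A` and EVERY `ex_j`, and `V` fails the non-birth test).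
* `cleanPermissibleAt_sideTrace_or_birth_general` — the trace `N = (e', s_{j₀})` of a side: clean-permissible unless birth.
* `cleanPermissibleAt_exceptionalCurve_or_obstruction_of_sides_general`, `cleanPermissibleAt_exceptionalTrace_or_birth_general` — the same at a point of a
  blowing up (✓ `exists_sideFamily_of_isBlowup`), for clean-permissible data `u · ∏ c^a · ∏ w^b` with ARBITRARY `a`, `b`: sides are the charged `c_k` with
  `p ∤ a_k` and the `w_m` with `p ∤ b_m`; in the birth case the transform is `U · e'^{Σ a} · D^p` with `U` a unit failing the non-birth test and `D ≠ 0`.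

Honest framing: OURS, bookkeeping; a TOOL for the (R1ᵐⁱⁿ)/(R3ᵐⁱⁿ′) provers (insertion chains read on raw transform data).  Nothing here proves X44c,
any case of `CleanModels`, or resolution of singularities in characteristic `p`.  Setting only: [cite: Piltant2013, §2 Axiom 4]
[cite: CossartPiltant2008, Lemma 4.3 (4)–(5)] [cite: Matsumura1987, Thm. 14.2].
-/

noncomputable section

set_option linter.dupNamespace false -- mandated namespace of this single-conjunct summit

open IsLocalRing CategoryTheory AlgebraicGeometry
open Literature.AlgebraicGeometry.Resolution Literature.AlgebraicGeometry.Motives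

namespace Summit.ResolutionOfSingularities.ResolutionOfSingularities.Theorems.RadicialJung.CleanModels

universe u

/-! ## §0 Splitting off the `p`-th power part of a monomial -/

/-- **Splitting off the `p`-divisible exponents**: `∏_j s_j^{ex_j} = (∏_j s_j^{ex'_j}) · (∏_j s_j^{q_j})^p` where `ex'_j = ex_j`, `q_j = 0` if `p ∤ ex_j` and
`ex'_j = 0`, `q_j = ex_j / p` if `p ∣ ex_j`. [folklore] -/
theorem prod_pow_eq_prod_pow_mod_mul_pow {R : Type u} [CommMonoid R] (p : ℕ) {r : ℕ} (s : Fin r → R) (ex : Fin r → ℕ) :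
    ∏ j, s j ^ ex j = (∏ j, s j ^ (if p ∣ ex j then 0 else ex j)) * (∏ j, s j ^ (if p ∣ ex j then ex j / p else 0)) ^ p := by
  classical
  rw [← Finset.prod_pow, ← Finset.prod_mul_distrib]
  refine Finset.prod_congr rfl fun j _ => ?_
  by_cases h : p ∣ ex j
  · rw [if_pos h, if_pos h, pow_zero, one_mul, ← pow_mul, Nat.div_mul_cancel h]
  · rw [if_neg h, if_neg h, pow_zero, one_pow, mul_one]

/-! ## §1 Local: side families with arbitrary exponents -/

set_option maxHeartbeats 400000 in
-- bookkeeping over the landed classification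
/-- **THE SIDE-FAMILY CLASSIFICATION WITH ARBITRARY EXPONENTS.**  As ✓ `cleanPermissibleAt_or_obstruction_of_sideFamily`, without the hypothesis that the
exponents are `0` or prime to `p`: sides whose exponent is divisible by `p` are absorbed into a `p`-th power factor of the representative and never
obstruct.  Conclusion: clean-permissible for `N = (e', z)`; or CORNER with two sides of exponent prime to `p`; or TANGENT side of exponent prime to `p`;
or BIRTH — `p ∣ A`, `p ∣ ex_j` for all `j`, and `V` fails the non-birth test. [cite: Piltant2013, §2 Axiom 4] [cite: CossartPiltant2008, Lemma 4.3 (5)] -/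
theorem cleanPermissibleAt_or_obstruction_of_sideFamily_general {R : Type u} {F : Type u} [CommRing R] [IsLocalRing R] [Field F] {p : ℕ}
    [Fact p.Prime] [CharP F p] (f : R →+* F) (hf : Function.Injective f) (hdim : ringKrullDim R = 3) {e' z z' : R}
    (hzz : Ideal.span ({e', z, z'} : Set R) = maximalIdeal R) {r : ℕ} {s : Fin r → R}
    (hrsop : IsRsopPart (Fin.cons e' s : Fin (r + 1) → R)) {G : F} (cc : Fin p → F) (hcc : ∃ j : Fin p, (j : ℕ) ≠ 0 ∧ cc j ≠ 0)
    {V : R} (hV : IsUnit V) (A : ℕ) (ex : Fin r → ℕ)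
    (hrep : (∑ j : Fin p, cc j ^ p * G ^ (j : ℕ)) = f (V * e' ^ A * ∏ j, s j ^ ex j)) :
    CleanPermissibleAt p f G (Ideal.span ({e', z} : Set R)) ∨
    (∃ j₁ j₂ : Fin r, j₁ ≠ j₂ ∧ ¬ p ∣ ex j₁ ∧ ¬ p ∣ ex j₂ ∧ Ideal.span ({e', s j₁, s j₂} : Set R) = maximalIdeal R ∧
        s j₁ ∉ Ideal.span ({e', z} : Set R) ∧ s j₂ ∉ Ideal.span ({e', z} : Set R)) ∨
    (∃ j : Fin r, ¬ p ∣ ex j ∧ s j ∉ Ideal.span ({e', z} : Set R) ∧ s j ∈ Ideal.span ({e', z} : Set R) ⊔ maximalIdeal R ^ 2) ∨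
    (p ∣ A ∧ (∀ j, p ∣ ex j) ∧
      ¬ ((∀ c' : R, V - c' ^ p ∉ maximalIdeal R) ∨
          (∃ c' : R, V - c' ^ p ∈ maximalIdeal R ∧ V - c' ^ p ∉ Ideal.span ({e', z} : Set R) ⊔ maximalIdeal R ^ 2) ∨
          (∃ c' : R, V - c' ^ p ∈ Ideal.span ({e', z} : Set R) ∧ V - c' ^ p ∉ maximalIdeal R ^ 2))) := by
  classical
  haveI : IsRegularLocalRing R := hrsop.isRegularLocalRing
  haveI := isDomain_of_isRegularLocalRing R
  have hs0 : ∀ j, s j ≠ 0 := fun j => by simpa using hrsop.ne_zero j.succ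
  -- remove the `p`-th power part of the monomial from the representative
  set ex' : Fin r → ℕ := fun j => if p ∣ ex j then 0 else ex j with hex'
  have hall' : ∀ j, ex' j = 0 ∨ ¬ p ∣ ex' j := by
    intro j
    by_cases h : p ∣ ex j
    · left; simp only [hex', h, if_true]
    · right; simp only [hex', h, if_false, not_false_eq_true]
  have hD : f (∏ j, s j ^ (if p ∣ ex j then ex j / p else 0)) ≠ 0 :=
    (map_ne_zero_iff f hf).mpr (Finset.prod_ne_zero_iff.mpr fun j _ => pow_ne_zero _ (hs0 j))
  have hrepD : (∑ j : Fin p, cc j ^ p * G ^ (j : ℕ)) =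
      f (V * e' ^ A * ∏ j, s j ^ ex' j) * f (∏ j, s j ^ (if p ∣ ex j then ex j / p else 0)) ^ p := by
    rw [hrep, prod_pow_eq_prod_pow_mod_mul_pow p s ex, ← mul_assoc, map_mul, map_pow]
  obtain ⟨cc', hcc', hrep'⟩ := exists_rep_of_rep_eq_mul_pow p G cc hcc hD hrepD
  -- translate the `0`-or-prime-to-`p` classification
  have hne : ∀ j, ex' j ≠ 0 ↔ ¬ p ∣ ex j := by
    intro j
    by_cases h : p ∣ ex j
    · simp only [hex', h, if_true, ne_eq, not_true_eq_false]
    · simp only [hex', h, if_false, ne_eq, not_false_eq_true, iff_true]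
      rintro h0
      exact h (h0 ▸ dvd_zero p)
  rcases cleanPermissibleAt_or_obstruction_of_sideFamily f hf hdim hzz hrsop cc' hcc' hV A hall' hrep' with
    h | ⟨j₁, j₂, hj, h₁, h₂, h𝔪, hN₁, hN₂⟩ | ⟨j, hj, hN, hmem⟩ | ⟨hA, h0, hnb⟩
  · exact Or.inl h
  · exact Or.inr (Or.inl ⟨j₁, j₂, hj, (hne _).mp h₁, (hne _).mp h₂, h𝔪, hN₁, hN₂⟩)
  · exact Or.inr (Or.inr (Or.inl ⟨j, (hne _).mp hj, hN, hmem⟩))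
  · refine Or.inr (Or.inr (Or.inr ⟨hA, fun j => ?_, hnb⟩))
    by_contra h
    exact ((hne j).mpr h) (h0 j)

/-- **The trace of a side, arbitrary exponents**: for `N = (e', s_{j₀})` (`(e', s_{j₀}, z') = 𝔪`) the line is clean-permissible, or `p ∣ A`, `p ∣ ex_j` for
all `j`, and `V` fails the non-birth test. [cite: Piltant2013, §2 Axiom 4] [cite: CossartPiltant2008, Lemma 4.3 (5)] -/
theorem cleanPermissibleAt_sideTrace_or_birth_general {R : Type u} {F : Type u} [CommRing R] [IsLocalRing R] [Field F] {p : ℕ}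
    [Fact p.Prime] [CharP F p] (f : R →+* F) (hf : Function.Injective f) (hdim : ringKrullDim R = 3) {e' : R} {r : ℕ} {s : Fin r → R}
    (hrsop : IsRsopPart (Fin.cons e' s : Fin (r + 1) → R)) (j₀ : Fin r) {z' : R}
    (hzz : Ideal.span ({e', s j₀, z'} : Set R) = maximalIdeal R) {G : F} (cc : Fin p → F) (hcc : ∃ j : Fin p, (j : ℕ) ≠ 0 ∧ cc j ≠ 0)
    {V : R} (hV : IsUnit V) (A : ℕ) (ex : Fin r → ℕ)
    (hrep : (∑ j : Fin p, cc j ^ p * G ^ (j : ℕ)) = f (V * e' ^ A * ∏ j, s j ^ ex j)) :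
    CleanPermissibleAt p f G (Ideal.span ({e', s j₀} : Set R)) ∨
    (p ∣ A ∧ (∀ j, p ∣ ex j) ∧
      ¬ ((∀ c' : R, V - c' ^ p ∉ maximalIdeal R) ∨
          (∃ c' : R, V - c' ^ p ∈ maximalIdeal R ∧ V - c' ^ p ∉ Ideal.span ({e', s j₀} : Set R) ⊔ maximalIdeal R ^ 2) ∨
          (∃ c' : R, V - c' ^ p ∈ Ideal.span ({e', s j₀} : Set R) ∧ V - c' ^ p ∉ maximalIdeal R ^ 2))) := by
  rcases cleanPermissibleAt_or_obstruction_of_sideFamily_general f hf hdim hzz hrsop cc hcc hV A ex hrep with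
    h | ⟨j₁, j₂, hne, -, -, -, hN₁, hN₂⟩ | ⟨j, -, hN, hmem⟩ | h
  · exact Or.inl h
  · exfalso
    have hj₁ : j₁ ≠ j₀ := fun h => hN₁ (h ▸ Ideal.subset_span (by simp))
    have hj₂ : j₂ ≠ j₀ := fun h => hN₂ (h ▸ Ideal.subset_span (by simp))
    rcases fin_eq_or_eq_of_le_two (le_two_of_isRsopPart_cons hrsop hdim) hne j₀ with h | h
    · exact hj₁ h.symm
    · exact hj₂ h.symm
  · exfalso
    have hj : j₀ ≠ j := fun h => hN (h ▸ Ideal.subset_span (by simp))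
    have htriple := isRsopPart_triple_of_cons hrsop hj
    have happ : (![e', s j₀, s j] : Fin 3 → R) = Fin.append ![e', s j₀] ![s j] := by
      funext t; fin_cases t <;> rfl
    rw [happ] at htriple
    have h1 := append_right_not_mem_span_sup_sq htriple 0
    have hr : Set.range ![e', s j₀] = {e', s j₀} := by
      ext t
      simp only [Set.mem_range, Set.mem_insert_iff, Set.mem_singleton_iff]
      constructor
      · rintro ⟨i, rfl⟩
        fin_cases i <;> simp
      · rintro (rfl | rfl)
        exacts [⟨0, rfl⟩, ⟨1, rfl⟩]
    have h2 : s j ∈ Ideal.span (Set.range ![e', s j₀]) ⊔ maximalIdeal R ^ 2 := by rw [hr]; exact hmem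
    exact h1 (by simpa using h2)
  · exact Or.inr h

/-! ## §2 Scheme level: clean-permissible data with arbitrary exponents -/

section Scheme

variable {p : ℕ} {X X' : Scheme.{u}} [IsIntegral X] [IsIntegral X'] {τ : X' ⟶ X} [IsDominant τ]
  {J : X.IdealSheafData}

set_option maxHeartbeats 800000 in
-- one long statement; the proof is a translation
/-- **THE LOCAL CLASSIFICATION at a point of the exceptional divisor, ARBITRARY EXPONENTS.**  As
✓ `cleanPermissibleAt_exceptionalCurve_or_obstruction_of_sides` without `hall`/`hallb`: a «side» is a charged `c_k` with `p ∤ a_k` (`τ^♯ c_k = e' · s`) or a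
`w_m` with `p ∤ b_m` (`τ^♯ w_m = s`); in the BIRTH case `p ∣ Σ a_k`, no `c_k` with `p ∤ a_k` passes through `x'`, `p ∣ b_m` for all `m`, and the transform
is `U · e'^{Σ a} · D^p` with `D ≠ 0` and `U` a unit failing the non-birth test. [cite: Piltant2013, §2 Axiom 4] [cite: CossartPiltant2008, Lemma 4.3 (4)–(5)] -/
theorem cleanPermissibleAt_exceptionalCurve_or_obstruction_of_sides_general [Fact p.Prime] [CharP X'.functionField p] (hτ : IsBlowup τ J)
    (x' : X') (hR : IsRegularLocalRing (X.presheaf.stalk (τ x'))) {n l : ℕ} (c : Fin n → X.presheaf.stalk (τ x'))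
    (w : Fin l → X.presheaf.stalk (τ x')) (hz : Ideal.span (Set.range (Fin.append c w)) = maximalIdeal (X.presheaf.stalk (τ x')))
    (hdim : ringKrullDim (X.presheaf.stalk (τ x')) = ((n + l : ℕ) : WithBot ℕ∞))
    (hcJ : Ideal.span (Set.range c) = stalkIdeal J (τ x'))
    {G : X.functionField} {cc : Fin p → X.functionField} (hcc : ∃ j : Fin p, (j : ℕ) ≠ 0 ∧ cc j ≠ 0)
    {u : X.presheaf.stalk (τ x')} (hu : IsUnit u) {a : Fin n → ℕ} {b : Fin l → ℕ}
    (hrep : (∑ j : Fin p, cc j ^ p * G ^ (j : ℕ)) = RatFn.toFunctionField (τ x') (u * (∏ k, c k ^ a k) * ∏ m, w m ^ b m))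
    (hdim' : ringKrullDim (X'.presheaf.stalk x') = 3) {e' z z' : X'.presheaf.stalk x'}
    (he' : Ideal.span {e'} = (stalkIdeal J (τ x')).map (τ.stalkMap x').hom)
    (hzz : Ideal.span ({e', z, z'} : Set (X'.presheaf.stalk x')) = maximalIdeal (X'.presheaf.stalk x')) :
    CleanPermissibleAt p (RatFn.toFunctionField x') (RatFn.functionFieldMap τ G) (Ideal.span ({e', z} : Set (X'.presheaf.stalk x'))) ∨
    (∃ s₁ s₂ : X'.presheaf.stalk x', s₁ ≠ s₂ ∧
        ((∃ k, ¬ p ∣ a k ∧ (τ.stalkMap x').hom (c k) = e' * s₁) ∨ (∃ m, ¬ p ∣ b m ∧ (τ.stalkMap x').hom (w m) = s₁)) ∧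
        ((∃ k, ¬ p ∣ a k ∧ (τ.stalkMap x').hom (c k) = e' * s₂) ∨ (∃ m, ¬ p ∣ b m ∧ (τ.stalkMap x').hom (w m) = s₂)) ∧
        Ideal.span ({e', s₁, s₂} : Set (X'.presheaf.stalk x')) = maximalIdeal (X'.presheaf.stalk x') ∧
        s₁ ∉ Ideal.span ({e', z} : Set (X'.presheaf.stalk x')) ∧ s₂ ∉ Ideal.span ({e', z} : Set (X'.presheaf.stalk x'))) ∨
    (∃ s : X'.presheaf.stalk x',
        ((∃ k, ¬ p ∣ a k ∧ (τ.stalkMap x').hom (c k) = e' * s) ∨ (∃ m, ¬ p ∣ b m ∧ (τ.stalkMap x').hom (w m) = s)) ∧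
        s ∈ maximalIdeal (X'.presheaf.stalk x') ∧ s ∉ Ideal.span ({e', z} : Set (X'.presheaf.stalk x')) ∧
        s ∈ Ideal.span ({e', z} : Set (X'.presheaf.stalk x')) ⊔ maximalIdeal (X'.presheaf.stalk x') ^ 2) ∨
    (p ∣ ∑ k, a k ∧ (∀ k, ¬ p ∣ a k → Ideal.span {(τ.stalkMap x').hom (c k)} = (stalkIdeal J (τ x')).map (τ.stalkMap x').hom) ∧
      (∀ m, p ∣ b m) ∧
      ∃ U D : X'.presheaf.stalk x', IsUnit U ∧ D ≠ 0 ∧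
        (∑ j : Fin p, RatFn.functionFieldMap τ (cc j) ^ p * RatFn.functionFieldMap τ G ^ (j : ℕ)) =
          RatFn.toFunctionField x' (U * e' ^ (∑ k, a k) * D ^ p) ∧
        ¬ ((∀ c' : X'.presheaf.stalk x', U - c' ^ p ∉ maximalIdeal (X'.presheaf.stalk x')) ∨
          (∃ c' : X'.presheaf.stalk x', U - c' ^ p ∈ maximalIdeal (X'.presheaf.stalk x') ∧
            U - c' ^ p ∉ Ideal.span ({e', z} : Set (X'.presheaf.stalk x')) ⊔ maximalIdeal (X'.presheaf.stalk x') ^ 2) ∨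
          (∃ c' : X'.presheaf.stalk x', U - c' ^ p ∈ Ideal.span ({e', z} : Set (X'.presheaf.stalk x')) ∧
            U - c' ^ p ∉ maximalIdeal (X'.presheaf.stalk x') ^ 2))) := by
  classical
  obtain ⟨r, s, ex, V, hrsop, hV, hcc', hrep', hdesc, hw, hc⟩ :=
    exists_sideFamily_of_isBlowup hτ x' hR c w hz hdim hcJ hcc hu hrep he'
  haveI : IsRegularLocalRing (X'.presheaf.stalk x') := hrsop.isRegularLocalRing
  haveI := isDomain_of_isRegularLocalRing (X'.presheaf.stalk x')
  have hside : ∀ j, ¬ p ∣ ex j →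
      (∃ k, ¬ p ∣ a k ∧ (τ.stalkMap x').hom (c k) = e' * s j) ∨ (∃ m, ¬ p ∣ b m ∧ (τ.stalkMap x').hom (w m) = s j) := by
    intro j hj
    rcases hdesc j with ⟨k, hk, hck⟩ | ⟨m, hm, hwm⟩
    · exact Or.inl ⟨k, by rw [hk]; exact hj, hck⟩
    · exact Or.inr ⟨m, by rw [hm]; exact hj, hwm⟩
  have hsm : ∀ j, s j ∈ maximalIdeal (X'.presheaf.stalk x') := fun j => by simpa using hrsop.mem_maximalIdeal j.succ
  have hs0 : ∀ j, s j ≠ 0 := fun j => by simpa using hrsop.ne_zero j.succ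
  rcases cleanPermissibleAt_or_obstruction_of_sideFamily_general (RatFn.toFunctionField x') (RatFn.toFunctionField_injective x') hdim' hzz
      hrsop _ hcc' hV (∑ k, a k) ex hrep' with hperm | ⟨j₁, j₂, hne, hj₁, hj₂, h𝔪, hN₁, hN₂⟩ | ⟨j, hj, hN, hmem⟩ | ⟨hA, hall0, hnb⟩
  · exact Or.inl hperm
  · right; left
    refine ⟨s j₁, s j₂, fun h => hne ?_, hside j₁ hj₁, hside j₂ hj₂, h𝔪, hN₁, hN₂⟩
    have h2 : (Fin.cons e' s : Fin (r + 1) → X'.presheaf.stalk x') j₁.succ = (Fin.cons e' s : Fin (r + 1) → X'.presheaf.stalk x') j₂.succ := by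
      simp only [Fin.cons_succ, h]
    exact Fin.succ_injective _ (hrsop.injective h2)
  · right; right; left
    exact ⟨s j, hside j hj, hsm j, hN, hmem⟩
  · right; right; right
    refine ⟨hA, fun k hk => ?_, fun m => ?_, V, ∏ j, s j ^ (ex j / p), hV,
      Finset.prod_ne_zero_iff.mpr fun j _ => pow_ne_zero _ (hs0 j), ?_, hnb⟩
    · rcases hc k (fun h => hk (h.symm ▸ dvd_zero p)) with h | ⟨j, -, hj⟩
      · exact h
      · exact absurd (hj ▸ hall0 j) hk
    · obtain ⟨j, -, hj⟩ := hw m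
      rw [← hj]; exact hall0 j
    · have hprod : ∏ j, s j ^ ex j = (∏ j, s j ^ (ex j / p)) ^ p := by
        rw [← Finset.prod_pow]
        exact Finset.prod_congr rfl fun j _ => by rw [← pow_mul, Nat.div_mul_cancel (hall0 j)]
      rw [hrep', hprod]

set_option maxHeartbeats 800000 in
-- one long statement; the proof is a translation
/-- **The trace of a transversal component, ARBITRARY EXPONENTS**: for `N = (e', τ^♯ w_{m₀})` (`(e', τ^♯ w_{m₀}, z') = 𝔪_{x'}`; the fibre `E_x` over a curve
centre on a threefold) the line of `τ^♯ G` is clean-permissible at `x'`, or `x'` is a birth: `p ∣ Σ a_k`, no `c_k` with `p ∤ a_k` through `x'`, `p ∣ b_m`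
for all `m`, transform `U · e'^{Σ a} · D^p` with `U` failing the non-birth test. [cite: Piltant2013, §2 Axiom 4] [cite: CossartPiltant2008, Lemma 4.3 (4)–(5)] -/
theorem cleanPermissibleAt_exceptionalTrace_or_birth_general [Fact p.Prime] [CharP X'.functionField p] (hτ : IsBlowup τ J)
    (x' : X') (hR : IsRegularLocalRing (X.presheaf.stalk (τ x'))) {n l : ℕ} (c : Fin n → X.presheaf.stalk (τ x'))
    (w : Fin l → X.presheaf.stalk (τ x')) (hz : Ideal.span (Set.range (Fin.append c w)) = maximalIdeal (X.presheaf.stalk (τ x')))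
    (hdim : ringKrullDim (X.presheaf.stalk (τ x')) = ((n + l : ℕ) : WithBot ℕ∞))
    (hcJ : Ideal.span (Set.range c) = stalkIdeal J (τ x'))
    {G : X.functionField} {cc : Fin p → X.functionField} (hcc : ∃ j : Fin p, (j : ℕ) ≠ 0 ∧ cc j ≠ 0)
    {u : X.presheaf.stalk (τ x')} (hu : IsUnit u) {a : Fin n → ℕ} {b : Fin l → ℕ}
    (hrep : (∑ j : Fin p, cc j ^ p * G ^ (j : ℕ)) = RatFn.toFunctionField (τ x') (u * (∏ k, c k ^ a k) * ∏ m, w m ^ b m))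
    (hdim' : ringKrullDim (X'.presheaf.stalk x') = 3) (m₀ : Fin l) {e' z' : X'.presheaf.stalk x'}
    (he' : Ideal.span {e'} = (stalkIdeal J (τ x')).map (τ.stalkMap x').hom)
    (hzz : Ideal.span ({e', (τ.stalkMap x').hom (w m₀), z'} : Set (X'.presheaf.stalk x')) = maximalIdeal (X'.presheaf.stalk x')) :
    CleanPermissibleAt p (RatFn.toFunctionField x') (RatFn.functionFieldMap τ G)
        (Ideal.span ({e', (τ.stalkMap x').hom (w m₀)} : Set (X'.presheaf.stalk x'))) ∨
    (p ∣ ∑ k, a k ∧ (∀ k, ¬ p ∣ a k → Ideal.span {(τ.stalkMap x').hom (c k)} = (stalkIdeal J (τ x')).map (τ.stalkMap x').hom) ∧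
      (∀ m, p ∣ b m) ∧
      ∃ U D : X'.presheaf.stalk x', IsUnit U ∧ D ≠ 0 ∧
        (∑ j : Fin p, RatFn.functionFieldMap τ (cc j) ^ p * RatFn.functionFieldMap τ G ^ (j : ℕ)) =
          RatFn.toFunctionField x' (U * e' ^ (∑ k, a k) * D ^ p) ∧
        ¬ ((∀ c' : X'.presheaf.stalk x', U - c' ^ p ∉ maximalIdeal (X'.presheaf.stalk x')) ∨
          (∃ c' : X'.presheaf.stalk x', U - c' ^ p ∈ maximalIdeal (X'.presheaf.stalk x') ∧
            U - c' ^ p ∉ Ideal.span ({e', (τ.stalkMap x').hom (w m₀)} : Set (X'.presheaf.stalk x')) ⊔ maximalIdeal (X'.presheaf.stalk x') ^ 2) ∨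
          (∃ c' : X'.presheaf.stalk x', U - c' ^ p ∈ Ideal.span ({e', (τ.stalkMap x').hom (w m₀)} : Set (X'.presheaf.stalk x')) ∧
            U - c' ^ p ∉ maximalIdeal (X'.presheaf.stalk x') ^ 2))) := by
  classical
  obtain ⟨r, s, ex, V, hrsop, hV, hcc', hrep', -, hw, hc⟩ :=
    exists_sideFamily_of_isBlowup hτ x' hR c w hz hdim hcJ hcc hu hrep he'
  haveI : IsRegularLocalRing (X'.presheaf.stalk x') := hrsop.isRegularLocalRing
  haveI := isDomain_of_isRegularLocalRing (X'.presheaf.stalk x')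
  have hs0 : ∀ j, s j ≠ 0 := fun j => by simpa using hrsop.ne_zero j.succ
  obtain ⟨j₀, hj₀, -⟩ := hw m₀
  rw [hj₀] at hzz ⊢
  rcases cleanPermissibleAt_sideTrace_or_birth_general (RatFn.toFunctionField x') (RatFn.toFunctionField_injective x') hdim' hrsop j₀ hzz
      _ hcc' hV (∑ k, a k) ex hrep' with hperm | ⟨hA, hall0, hnb⟩
  · exact Or.inl hperm
  · right
    refine ⟨hA, fun k hk => ?_, fun m => ?_, V, ∏ j, s j ^ (ex j / p), hV,
      Finset.prod_ne_zero_iff.mpr fun j _ => pow_ne_zero _ (hs0 j), ?_, hnb⟩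
    · rcases hc k (fun h => hk (h.symm ▸ dvd_zero p)) with h | ⟨j, -, hj⟩
      · exact h
      · exact absurd (hj ▸ hall0 j) hk
    · obtain ⟨j, -, hj⟩ := hw m
      rw [← hj]; exact hall0 j
    · have hprod : ∏ j, s j ^ ex j = (∏ j, s j ^ (ex j / p)) ^ p := by
        rw [← Finset.prod_pow]
        exact Finset.prod_congr rfl fun j _ => by rw [← pow_mul, Nat.div_mul_cancel (hall0 j)]
      rw [hrep', hprod]

end Scheme

end Summit.ResolutionOfSingularities.ResolutionOfSingularities.Theorems.RadicialJung.CleanModels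

end
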